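import Literature.Probability.Percolation.CLE6
import Literature.Probability.Percolation.LoopRepresentation
import Literature.Probability.RandomPlanarGeometry.LoopConfigurationsMetric
import Mathlib.MeasureTheory.Constructions.UnitInterval
import HarnessLib

/-!
# The full-plane Camia–Newman loop law (full-plane CLE₆) as a `d_CN`-object

Definition request D3 of route `CardyMagicRigidity` (summit `CriticalPhenomena`, sub-problem
`CardyFormulaZ2`): the law of the *full-plane* Continuum Nonsimple Loop process of
F. Camia, C. M. Newman, *Two-dimensional critical percolation: the full scaling limit*,
Comm. Math. Phys. 268 (2006) 1–38 (`CamiaNewman2006`), Theorems 1 and 6 — the scaling limit of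
the collection of **all** cluster-interface loops of critical site percolation on `δ𝕋` in the
whole plane — as an object that can be compared with lattice loop ensembles in the coupling
distance `d_CN` of Duminil-Copin–Kozlowski–Krachun–Manolescu–Oulamara (arXiv:2012.11672v2, §1.2,
eq. (1)–(2); `Literature.Probability.RandomPlanarGeometry.LoopConfig.cnLawEDist`), the metric in
which the route states full-plane loop universality `ℤ² ∼ 𝕋` and its rigidity crux
("`Λ_P` Gaussian for all admissible `f` ⇒ `P` is the full-plane CLE₆ law").

## The framework and what "law" means here

DKKMO's space `C` of typed loop configurations (`LoopConfig ℂ`: two families `F 0`, `F 1` of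
unbased loops) carries no σ-algebra or topology in the tree (and none in the paper: the
exceptional set `{d_CN(ω, ω') > ε}` of eq. (2) is measured inside a coupling of the two
*lattice* measures). Accordingly a law on `C` is presented by a random configuration
`X : Ω → LoopConfig ℂ` on a probability space `(Ω, μ)`, two presentations being *the same law*
when `cnLawEDist μ X μ' X' = 0`. This is also the only meaningful identity: configurations that
differ by reversing the orientation of some members are `d_CN`-indistinguishable
(`LoopConfig.IsClose.of_forall_mem_or_reverse_mem`), so no presentation as a literal measure
could be unique. The domain version of the Camia–Newman theorem in the Aizenman–Burchard space is
`Literature.Probability.Percolation.exists_isCNLFamily_tendsto` (`CLE6.lean`); the present file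
is its whole-plane, typed, unbased (`d_CN`) companion.

## Contents

* `siteLoopConfig δ ω : LoopConfig ℂ` — the typed full-plane loop configuration of the site
  configuration `ω` on `δ𝕋`: `F i` is the set of unbased loops of the honeycomb interface loops
  `γ` of `ω` (`IsSiteInterfaceLoop ω γ`, open hexagons on the left, drawn by `siteLoopCurve δ γ`)
  of type `i`, type `1` ⟺ counter-clockwise (positive shoelace sum of the visited hexagon
  centres) ⟺ the open cluster is inside, i.e. the loop is the exterior boundary of an open
  ("primal") cluster (DKKMO §1.2: "a loop is in `F₁` if it is the exterior boundary of a primal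
  cluster, and in `F₀` if it is the exterior boundary of a dual cluster"). This is *verbatim* the
  configuration written inline in the route items of `CardyMagicRigidity` (`siteLoopConfig_eq`,
  `rfl`).
* `IsFullPlaneCNLLaw μ X` — the law of `X` under `μ` **is a full-plane CNL (CLE₆) law**:
  `d_CN((P_{1/2}, siteLoopConfig δ), (μ, X)) → 0` as `δ → 0⁺`. This predicate is the recommended
  Lean rendering of "`P` = the full-plane CLE₆ law".
* `exists_isFullPlaneCNLLaw` — **named fact** (Camia–Newman 2006, Thms 1 and 6): such a law
  exists; presented on the unit interval with Lebesgue measure.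
* `fullPlaneCNLLaw : unitInterval → LoopConfig ℂ` — *the* full-plane CNL law: a presentation
  chosen once and for all (`Classical.choose`; junk value the empty configuration if the fact
  failed), with `isFullPlaneCNLLaw_fullPlaneCNLLaw`.
* Proved API: uniqueness up to `d_CN` (`IsFullPlaneCNLLaw.cnLawEDist_eq_zero`, Camia–Newman
  Thm 6 "unique", via the triangle inequality `cnLawEDist_triangle`), stability
  (`IsFullPlaneCNLLaw.of_cnLawEDist_eq_zero`), the lattice-side measurability package
  (`measurable_isSiteInterfaceLoop`, `gen_siteLoopConfig`, `measurableSet_isClose_siteLoopConfig`,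
  `standardBorelSpace_siteConfig`, `cnLawEDist_siteLoopConfig_self`) and the Cauchy property of
  the lattice loop ensembles that the fact entails
  (`exists_isFullPlaneCNLLaw.cnLawEDist_siteLoopConfig_le`).

## Rendering notes (honesty)

* Printed topology. CMP 268 Thm 1: "In the continuum scaling limit, the probability
  distribution of the collection of all boundary contours of critical site percolation on the
  triangular lattice converges to a probability distribution on collections of continuous,
  nonsimple loops"; proof (§6, "Proof of Theorems 1 and 3"): "immediate consequences of
  Theorems 5 and 6, where the full scaling limit is intended in the topology induced by (Dist)",
  i.e. convergence in distribution on the complete separable metric space `Ω` of closed sets of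
  curves in the compactified plane `Ṙ²` (curves modulo monotone reparametrisation, uniform
  distance `D` for the spherical metric `Δ`, induced Hausdorff metric `Dist`, §2.1–2.2), the
  limit samples containing a trivial loop at each point of `ℂ ∪ {∞}` (§3.2 and Thm 6); Thm 6:
  "There exists a unique probability measure `P` on the space `Ω` [...] such that `P_R → P` as
  `R → ∞`". The `d_CN` form below compares only the loops inside the window `B(0, 1/ε)`, through
  DKKMO's unbased unoriented distance `d` (eq. (1), controlled on bounded sets by the based
  distance for `Δ`), records the orientation as the type (CMP 268 §5.2: "each continuum
  nonsimple loop has either a clockwise or counterclockwise direction, with the set of all loops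
  surrounding any deterministic point alternating in direction") and carries no trivial loops;
  it follows from Thm 1 with Thm 2 (ii) (every point is surrounded by loops of both orientations
  with diameters going to zero, so microscopic lattice loops are matched by small continuum loops
  of the same type, and conversely by the elementary density of isolated open / closed sites of
  `δ𝕋`). It is the metric that DKKMO (§1.2: "In [CamNew06], Camia and Newman introduced a
  convenient way of measuring the geometry of large clusters [...] Define the metric on `C`,
  `d_CN` [...]") attribute to this paper, and the one in which the requesting route consumes the
  law.
* Sample space. The printed `P` is a Borel probability measure on the Polish space `Ω`; every
  such measure is the image of Lebesgue measure on `[0, 1]` under a Borel map, and couplings lift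
  along such a map (disintegration), so presenting the law on `unitInterval` loses nothing.
* Not recorded here (separate facts if needed): the almost sure features of Thm 2 (local
  finiteness, non-crossing, touching, no triple points), the `SLE₆` construction (Thm 3),
  translation / rotation / scale invariance and the conformal restriction property (Thm 7).

## References

* F. Camia, C. M. Newman, Comm. Math. Phys. 268 (2006) 1–38 (arXiv:math/0605035): Thm 1,
  Thm 2, §2.1–2.2, §3.2, §5.2 (Thms 5–7, orientation of the loops) and §6 (proofs of Thms 1, 3, 6).
* H. Duminil-Copin, K. K. Kozlowski, D. Krachun, I. Manolescu, M. Oulamara, arXiv:2012.11672v2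
  (2026), §1.2 (space `C`, `d_CN`, eq. (1)–(2), typing by primal / dual exterior boundaries).
* C. Villani, *Optimal Transport* (2009), Ch. 1 (gluing of couplings, through
  `LoopConfig.cnLawEDist_triangle`).
-/

noncomputable section

open Set Filter MeasureTheory
open scoped Topology ENNReal unitInterval

namespace Literature.Probability.Percolation

open LatticeModels

/-! ### The typed full-plane loop configuration of site percolation on `δ𝕋` -/

/-- **The typed full-plane loop configuration of `ω` on `δ𝕋`** as a point of DKKMO's space `C`
(arXiv:2012.11672v2, §1.2): `F i` is the set of unbased loops
`UnbasedLoop.mk (BasedLoop.mk (siteLoopCurve δ γ) _)` of the honeycomb interface loops `γ` of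
`ω` (`IsSiteInterfaceLoop ω γ`: cycles of `hexGraph` with open hexagons on the left, closed ones
on the right; Camia–Newman, CMP 268 (2006), §4) of type `i`, where the type is `1` iff the loop
is traversed counter-clockwise — positive shoelace sum of the visited hexagon centres
`γ.support.map hexCenter` — iff the open cluster on its left lies inside, i.e. the loop is the
exterior boundary of an open (primal) cluster ("a loop is in `F₁` if it is the exterior boundary
of a primal cluster, and in `F₀` if it is the exterior boundary of a dual cluster", DKKMO §1.2).
Whole-plane configuration `ω`, no boundary condition and no window (the window `B(0, 1/ε)`
enters through `d_CN`); only `δ > 0` is meaningful. The body is verbatim the configuration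
written inline in the items of route `CardyMagicRigidity` (`siteLoopConfig_eq`).
[cite: arXiv201211672v2, §1.2] -/
def siteLoopConfig (δ : ℝ) (ω : SiteConfig (Site 2)) : RandomPlanarGeometry.LoopConfig ℂ where
  F i := {u : RandomPlanarGeometry.UnbasedLoop ℂ | ∃ (v : HexVertex) (γ : hexGraph.Walk v v),
    IsSiteInterfaceLoop ω γ ∧ (i = 1 ↔ 0 < shoelace (γ.support.map hexCenter)) ∧
      u = RandomPlanarGeometry.UnbasedLoop.mk (RandomPlanarGeometry.BasedLoop.mk
        (siteLoopCurve δ γ) (isLoop_siteLoopCurve δ γ))}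

/-- Membership in the typed site-percolation loop configuration, unfolded. [cite: arXiv201211672v2, §1.2] -/
theorem mem_siteLoopConfig_iff {δ : ℝ} {ω : SiteConfig (Site 2)} {i : Fin 2}
    {u : RandomPlanarGeometry.UnbasedLoop ℂ} :
    u ∈ (siteLoopConfig δ ω).F i ↔ ∃ (v : HexVertex) (γ : hexGraph.Walk v v),
      IsSiteInterfaceLoop ω γ ∧ (i = 1 ↔ 0 < shoelace (γ.support.map hexCenter)) ∧
        u = RandomPlanarGeometry.UnbasedLoop.mk (RandomPlanarGeometry.BasedLoop.mk
          (siteLoopCurve δ γ) (isLoop_siteLoopCurve δ γ)) :=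
  Iff.rfl

/-- The random configuration written inline in the items of route `CardyMagicRigidity`
(`LoopLimitZ2EqT`, `NestingRigidity`, `LoopsToCrossings`, `TransferContinuity`) is
`siteLoopConfig δ`, definitionally. [folklore] -/
theorem siteLoopConfig_eq (δ : ℝ) :
    (fun cfg : SiteConfig (Site 2) ↦ (⟨fun i ↦ {u : RandomPlanarGeometry.UnbasedLoop ℂ |
      ∃ (v : HexVertex) (γ : hexGraph.Walk v v), IsSiteInterfaceLoop cfg γ ∧
        (i = 1 ↔ 0 < shoelace (γ.support.map hexCenter)) ∧
          u = RandomPlanarGeometry.UnbasedLoop.mk (RandomPlanarGeometry.BasedLoop.mk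
            (siteLoopCurve δ γ) (isLoop_siteLoopCurve δ γ))}⟩ :
              RandomPlanarGeometry.LoopConfig ℂ)) = siteLoopConfig δ :=
  rfl

/-! ### Lattice-side measurability -/

/-- Being a site interface loop is, for every fixed closed honeycomb walk `γ`, a measurable event
of the site configuration: a finite conjunction over the darts of `γ` of countable disjunctions
of two-site cylinder events (Camia–Newman, CMP 268 (2006), §2.2: the loop laws are Borel
probability measures; Aizenman–Burchard 1999, §2.1). [folklore] -/
theorem measurable_isSiteInterfaceLoop {v : HexVertex} (γ : hexGraph.Walk v v) :
    Measurable fun ω : SiteConfig (Site 2) ↦ IsSiteInterfaceLoop ω γ := by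
  haveI : Countable triGraph.Dart := SimpleGraph.Dart.toProd_injective.countable
  haveI : Countable hexGraph.Dart := SimpleGraph.Dart.toProd_injective.countable
  show Measurable fun ω : SiteConfig (Site 2) ↦ γ.IsCycle ∧ ∀ d : hexGraph.Dart, d ∈ γ.darts →
    ∃ e : triGraph.Dart, triEdgeFaces e = (d.snd, d.fst) ∧ e.fst ∈ ω ∧ e.snd ∉ ω
  exact measurable_const.and <| Measurable.forall fun d ↦ measurable_const.imp <|
    Measurable.exists fun e ↦ measurable_const.and <|
      (measurable_set_mem e.fst).and (measurable_set_mem e.snd).not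

/-- The index type of closed honeycomb walks (with their base face) is countable (walks inject
into lists of faces, `SimpleGraph.Walk.support_injective`). [folklore] -/
theorem countable_sigma_hexLoop : Countable (Σ v : HexVertex, hexGraph.Walk v v) := by
  haveI : ∀ v : HexVertex, Countable (hexGraph.Walk v v) := fun _ ↦
    SimpleGraph.Walk.support_injective.countable
  infer_instance

/-- The typed loop configuration of site percolation is *countably generated* in the sense of
`LoopConfig.isClose_iff_of_gen`: `F i` is the set of the loops `f i k`, `k = ⟨v, γ⟩` a closed
honeycomb walk, whose events `S i k = {γ is an interface loop of ω of type i}` occur. [folklore] -/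
theorem gen_siteLoopConfig (δ : ℝ) :
    ∀ (ω : SiteConfig (Site 2)) (i : Fin 2) (u : RandomPlanarGeometry.UnbasedLoop ℂ),
      u ∈ (siteLoopConfig δ ω).F i ↔ ∃ k : Σ v : HexVertex, hexGraph.Walk v v,
        ω ∈ {ω : SiteConfig (Site 2) | IsSiteInterfaceLoop ω k.2 ∧
          (i = 1 ↔ 0 < shoelace (k.2.support.map hexCenter))} ∧
        RandomPlanarGeometry.UnbasedLoop.mk (RandomPlanarGeometry.BasedLoop.mk
          (siteLoopCurve δ k.2) (isLoop_siteLoopCurve δ k.2)) = u := by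
  intro ω i u
  constructor
  · rintro ⟨v, γ, h₁, h₂, rfl⟩
    exact ⟨⟨v, γ⟩, ⟨h₁, h₂⟩, rfl⟩
  · rintro ⟨⟨v, γ⟩, ⟨h₁, h₂⟩, rfl⟩
    exact ⟨v, γ, h₁, h₂, rfl⟩

/-- The generating events of `gen_siteLoopConfig` are measurable. [folklore] -/
theorem measurableSet_gen_siteLoopConfig (i : Fin 2) (k : Σ v : HexVertex, hexGraph.Walk v v) :
    MeasurableSet {ω : SiteConfig (Site 2) | IsSiteInterfaceLoop ω k.2 ∧
      (i = 1 ↔ 0 < shoelace (k.2.support.map hexCenter))} :=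
  ((measurable_isSiteInterfaceLoop k.2).and measurable_const).setOf

/-- **Measurability of the exceptional event of `d_CN`** between the typed site-percolation
configurations at two meshes: `{(ω, ω') | d_CN(siteLoopConfig δ ω, siteLoopConfig δ' ω') ≤ ε}`
is measurable on pairs of configurations (`LoopConfig.measurableSet_isClose_of_gen`), so the
couplings of DKKMO eq. (2) measure genuine events. [folklore] -/
theorem measurableSet_isClose_siteLoopConfig (δ δ' ε : ℝ) :
    MeasurableSet {p : SiteConfig (Site 2) × SiteConfig (Site 2) |
      RandomPlanarGeometry.LoopConfig.IsClose ε (siteLoopConfig δ p.1) (siteLoopConfig δ' p.2)} := by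
  haveI := countable_sigma_hexLoop
  exact RandomPlanarGeometry.LoopConfig.measurableSet_isClose_of_gen
    (measurableSet_gen_siteLoopConfig) (gen_siteLoopConfig δ)
    (measurableSet_gen_siteLoopConfig) (gen_siteLoopConfig δ') ε

/-- `SiteConfig (Site 2) = Set ℤ²` (a countable product of two-point spaces) is a standard
Borel space; needed to glue couplings (`LoopConfig.cnLawEDist_triangle`). [folklore] -/
theorem standardBorelSpace_siteConfig : StandardBorelSpace (SiteConfig (Site 2)) := by
  unfold SiteConfig Set
  exact StandardBorelSpace.pi_countable (α := fun _ ↦ Prop)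

/-- `d_CN` of the typed site-percolation loop ensemble at mesh `δ` to itself vanishes (diagonal
coupling, `LoopConfig.cnLawEDist_self`). [folklore] -/
theorem cnLawEDist_siteLoopConfig_self (δ : ℝ) :
    RandomPlanarGeometry.LoopConfig.cnLawEDist (triSitePercolation half) (siteLoopConfig δ)
      (triSitePercolation half) (siteLoopConfig δ) = 0 :=
  RandomPlanarGeometry.LoopConfig.cnLawEDist_self _ _ (measurableSet_isClose_siteLoopConfig δ δ)

/-! ### Full-plane CNL laws -/

section Law

variable {Ω Ω' : Type*} [MeasurableSpace Ω] [MeasurableSpace Ω']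

/-- **The law of `X` under `μ` is a full-plane Continuum-Nonsimple-Loop (CLE₆) law**: the typed
loop ensembles `siteLoopConfig δ` of critical site percolation on `δ𝕋` (`triSitePercolation half`,
`p = p_c = 1/2`, whole plane) converge to it as `δ → 0⁺` in DKKMO's coupling distance,
`d_CN((P_{1/2}, siteLoopConfig δ), (μ, X)) → 0` (`LoopConfig.cnLawEDist`, arXiv:2012.11672v2
eq. (2), over the printed `d_CN` of §1.2 / eq. (1)). By Camia–Newman (CMP 268 (2006), Thms 1
and 6; named fact `exists_isFullPlaneCNLLaw`) such laws exist, and any two are at coupling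
distance `0` (`IsFullPlaneCNLLaw.cnLawEDist_eq_zero`); this predicate is therefore the Lean
rendering of "`(μ, X)` is the full-plane CLE₆ law". [cite: CamiaNewman2006, Thm 1]
[cite: arXiv201211672v2, eq. (2)] -/
def IsFullPlaneCNLLaw (μ : Measure Ω) (X : Ω → RandomPlanarGeometry.LoopConfig ℂ) : Prop :=
  Tendsto (fun δ : ℝ ↦ RandomPlanarGeometry.LoopConfig.cnLawEDist (triSitePercolation half)
    (siteLoopConfig δ) μ X) (𝓝[>] 0) (𝓝 0)

/-- Unfolding `IsFullPlaneCNLLaw`. [cite: CamiaNewman2006, Thm 1] -/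
theorem isFullPlaneCNLLaw_iff {μ : Measure Ω} {X : Ω → RandomPlanarGeometry.LoopConfig ℂ} :
    IsFullPlaneCNLLaw μ X ↔ Tendsto (fun δ : ℝ ↦ RandomPlanarGeometry.LoopConfig.cnLawEDist
      (triSitePercolation half) (siteLoopConfig δ) μ X) (𝓝[>] 0) (𝓝 0) :=
  Iff.rfl

/-- `ε`-form of `IsFullPlaneCNLLaw`: for every `η > 0`, for all small `δ > 0` there is a coupling
of `P_{1/2}` and `μ` under which the lattice ensemble `siteLoopConfig δ` and `X` fail to be
`η`-close (printed relation `d_CN ≤ η`) with probability `< η`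
(`LoopConfig.exists_coupling_of_cnLawEDist_lt`). [cite: arXiv201211672v2, eq. (2)] -/
theorem IsFullPlaneCNLLaw.eventually_exists_coupling {μ : Measure Ω}
    {X : Ω → RandomPlanarGeometry.LoopConfig ℂ} (h : IsFullPlaneCNLLaw μ X) {η : ℝ} (hη : 0 < η) :
    ∀ᶠ δ in 𝓝[>] (0 : ℝ), ∃ P : Measure (SiteConfig (Site 2) × Ω),
      P.map Prod.fst = triSitePercolation half ∧ P.map Prod.snd = μ ∧
        P {p | ¬ RandomPlanarGeometry.LoopConfig.IsClose η (siteLoopConfig δ p.1) (X p.2)} <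
          ENNReal.ofReal η := by
  have hlt : ∀ᶠ δ in 𝓝[>] (0 : ℝ), RandomPlanarGeometry.LoopConfig.cnLawEDist
      (triSitePercolation half) (siteLoopConfig δ) μ X < ENNReal.ofReal η :=
    h (Iio_mem_nhds (ENNReal.ofReal_pos.2 hη))
  filter_upwards [hlt] with δ hδ
  exact RandomPlanarGeometry.LoopConfig.exists_coupling_of_cnLawEDist_lt hδ

/-- **Uniqueness of the full-plane CNL law up to `d_CN`** (Camia–Newman, CMP 268 (2006), Thm 6:
"There exists a *unique* probability measure `P` [...]"; here in the coupling distance): two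
full-plane CNL laws, presented on standard Borel probability spaces with a measurable mutual
exceptional event, are at coupling distance `0`. Proof: `d_CN(X, X') ≤ d_CN(X, 𝕋_δ) +
d_CN(𝕋_δ, X')` for every `δ > 0` (gluing, `LoopConfig.cnLawEDist_triangle`) and the right-hand
side tends to `0`. [folklore] -/
theorem IsFullPlaneCNLLaw.cnLawEDist_eq_zero [StandardBorelSpace Ω] [Nonempty Ω]
    [StandardBorelSpace Ω'] [Nonempty Ω'] {μ : Measure Ω} [IsProbabilityMeasure μ]
    {μ' : Measure Ω'} [IsProbabilityMeasure μ'] {X : Ω → RandomPlanarGeometry.LoopConfig ℂ}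
    {X' : Ω' → RandomPlanarGeometry.LoopConfig ℂ} (h : IsFullPlaneCNLLaw μ X)
    (h' : IsFullPlaneCNLLaw μ' X')
    (hm : ∀ ε, MeasurableSet {p : Ω × Ω' | RandomPlanarGeometry.LoopConfig.IsClose ε (X p.1) (X' p.2)}) :
    RandomPlanarGeometry.LoopConfig.cnLawEDist μ X μ' X' = 0 := by
  refine le_antisymm ?_ bot_le
  have hle : ∀ δ : ℝ, RandomPlanarGeometry.LoopConfig.cnLawEDist μ X μ' X' ≤
      RandomPlanarGeometry.LoopConfig.cnLawEDist (triSitePercolation half) (siteLoopConfig δ) μ X +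
        RandomPlanarGeometry.LoopConfig.cnLawEDist (triSitePercolation half) (siteLoopConfig δ)
          μ' X' := by
    intro δ
    calc RandomPlanarGeometry.LoopConfig.cnLawEDist μ X μ' X'
        ≤ RandomPlanarGeometry.LoopConfig.cnLawEDist μ X (triSitePercolation half) (siteLoopConfig δ) +
            RandomPlanarGeometry.LoopConfig.cnLawEDist (triSitePercolation half) (siteLoopConfig δ)
              μ' X' :=
          RandomPlanarGeometry.LoopConfig.cnLawEDist_triangle μ (triSitePercolation half) μ' X
            (siteLoopConfig δ) X' hm
      _ = _ := by rw [RandomPlanarGeometry.LoopConfig.cnLawEDist_comm μ X]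
  have hlim : Tendsto (fun δ : ℝ ↦
      RandomPlanarGeometry.LoopConfig.cnLawEDist (triSitePercolation half) (siteLoopConfig δ) μ X +
        RandomPlanarGeometry.LoopConfig.cnLawEDist (triSitePercolation half) (siteLoopConfig δ)
          μ' X') (𝓝[>] 0) (𝓝 0) := by
    simpa using h.add h'
  exact ge_of_tendsto hlim (Eventually.of_forall hle)

/-- **Stability**: a law at coupling distance `0` from a full-plane CNL law is a full-plane CNL
law (`d_CN(𝕋_δ, Y) ≤ d_CN(𝕋_δ, X) + d_CN(X, Y)`, gluing), for `Y` on a standard Borel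
probability space with measurable exceptional events against the lattice ensembles. [folklore] -/
theorem IsFullPlaneCNLLaw.of_cnLawEDist_eq_zero [StandardBorelSpace Ω'] [Nonempty Ω']
    {μ : Measure Ω} [IsProbabilityMeasure μ] {μ' : Measure Ω'} [IsProbabilityMeasure μ']
    {X : Ω → RandomPlanarGeometry.LoopConfig ℂ} {Y : Ω' → RandomPlanarGeometry.LoopConfig ℂ}
    (h : IsFullPlaneCNLLaw μ X) (h0 : RandomPlanarGeometry.LoopConfig.cnLawEDist μ X μ' Y = 0)
    (hm : ∀ δ ε, MeasurableSet {p : SiteConfig (Site 2) × Ω' |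
      RandomPlanarGeometry.LoopConfig.IsClose ε (siteLoopConfig δ p.1) (Y p.2)}) :
    IsFullPlaneCNLLaw μ' Y := by
  haveI := standardBorelSpace_siteConfig
  refine tendsto_of_tendsto_of_tendsto_of_le_of_le tendsto_const_nhds h (fun _ ↦ bot_le)
    fun δ ↦ ?_
  calc RandomPlanarGeometry.LoopConfig.cnLawEDist (triSitePercolation half) (siteLoopConfig δ) μ' Y
      ≤ RandomPlanarGeometry.LoopConfig.cnLawEDist (triSitePercolation half) (siteLoopConfig δ) μ X +
          RandomPlanarGeometry.LoopConfig.cnLawEDist μ X μ' Y :=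
        RandomPlanarGeometry.LoopConfig.cnLawEDist_triangle (triSitePercolation half) μ μ'
          (siteLoopConfig δ) X Y (hm δ)
    _ = _ := by rw [h0, add_zero]

end Law

/-! ### Camia–Newman: existence of the full-plane law (named fact) and the chosen presentation -/

/-- **Existence of the full-plane Continuum Nonsimple Loop (CLE₆) law** (F. Camia, C. M. Newman,
*Two-dimensional critical percolation: the full scaling limit*, Comm. Math. Phys. 268 (2006),
Thm 1: "In the continuum scaling limit, the probability distribution of the collection of all
boundary contours of critical site percolation on the triangular lattice converges to a
probability distribution on collections of continuous, nonsimple loops", whole plane, proved in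
§6 as a consequence of Thm 5 (discs) and Thm 6: "There exists a unique probability measure `P`
on the space `Ω` of collections of continuous curves in `Ṙ²` such that `P_R → P` as `R → ∞`").
Rendered in DKKMO's coupling distance `d_CN` (arXiv:2012.11672v2, §1.2, where this metric is
attributed to [CamNew06], and eq. (2)): there is a random typed loop configuration `X`, presented
on the unit interval with Lebesgue measure, whose law is a full-plane CNL law
(`IsFullPlaneCNLLaw volume X`): `d_CN((P_{1/2}, siteLoopConfig δ), (Leb, X)) → 0` as `δ → 0⁺`.
See the module docstring ("Rendering notes") for the passage from the printed topology (closed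
sets of curves in the compactified plane, Hausdorff metric over the uniform distance, trivial
loops included) to the typed, unbased, windowed `d_CN` form (Thm 2 (ii): small loops of both
orientations are dense; orientation = type, CMP 268 §5.2), and for the presentation on `[0, 1]`
(every Borel probability measure on the Polish space `Ω` is an image of Lebesgue measure).
[cite: CamiaNewman2006, Thm 1 and Thm 6] -/
def exists_isFullPlaneCNLLaw : Prop :=
  ∃ X : unitInterval → RandomPlanarGeometry.LoopConfig ℂ, IsFullPlaneCNLLaw volume X

open scoped Classical in
/-- **The full-plane Camia–Newman loop law (full-plane CLE₆)** as an object: a presentation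
`fullPlaneCNLLaw : [0, 1] → C` on the unit interval with Lebesgue measure of the `d_CN`-limit
law of the typed loop ensembles of critical site percolation on `δ𝕋`, chosen by
`Classical.choose` from the Camia–Newman existence theorem (`exists_isFullPlaneCNLLaw`, CMP 268
(2006), Thms 1 and 6); junk value (the empty configuration) should that fact fail. All uses go
through `isFullPlaneCNLLaw_fullPlaneCNLLaw`; statements of the form "`(μ, X)` is the full-plane
CLE₆ law" are best written `IsFullPlaneCNLLaw μ X` (equivalently, up to the measurability needed
for gluing couplings, `cnLawEDist μ X volume fullPlaneCNLLaw = 0`: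
`IsFullPlaneCNLLaw.cnLawEDist_eq_zero`, `IsFullPlaneCNLLaw.of_cnLawEDist_eq_zero`).
[cite: CamiaNewman2006, Thm 1 and Thm 6] -/
def fullPlaneCNLLaw : unitInterval → RandomPlanarGeometry.LoopConfig ℂ :=
  if h : exists_isFullPlaneCNLLaw then Classical.choose h else fun _ ↦ ⟨fun _ ↦ ∅⟩

/-- The chosen presentation is a full-plane CNL law: the typed loop ensembles of critical site
percolation on `δ𝕋` converge to `fullPlaneCNLLaw` in `d_CN` (given the Camia–Newman fact).
[cite: CamiaNewman2006, Thm 1 and Thm 6] -/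
theorem isFullPlaneCNLLaw_fullPlaneCNLLaw (h : exists_isFullPlaneCNLLaw) :
    IsFullPlaneCNLLaw volume fullPlaneCNLLaw := by
  rw [fullPlaneCNLLaw, dif_pos h]
  exact Classical.choose_spec h

/-- **The lattice loop ensembles are `d_CN`-Cauchy** (consequence of the Camia–Newman fact at
the lattice level, no continuum object in the statement): for every `η > 0`, for all small
meshes `δ, δ' > 0`, `d_CN((P_{1/2}, siteLoopConfig δ), (P_{1/2}, siteLoopConfig δ')) ≤ η`
(gluing the two couplings with the limit law, `LoopConfig.cnLawEDist_triangle`; the lattice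
exceptional events are measurable, `measurableSet_isClose_siteLoopConfig`). [folklore] -/
theorem exists_isFullPlaneCNLLaw.cnLawEDist_siteLoopConfig_le (h : exists_isFullPlaneCNLLaw)
    {η : ℝ≥0∞} (hη : 0 < η) :
    ∀ᶠ p : ℝ × ℝ in (𝓝[>] 0) ×ˢ (𝓝[>] 0),
      RandomPlanarGeometry.LoopConfig.cnLawEDist (triSitePercolation half) (siteLoopConfig p.1)
        (triSitePercolation half) (siteLoopConfig p.2) ≤ η := by
  haveI := standardBorelSpace_siteConfig
  obtain ⟨X, hX⟩ := h
  set f : ℝ → ℝ≥0∞ := fun δ ↦ RandomPlanarGeometry.LoopConfig.cnLawEDist (triSitePercolation half)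
    (siteLoopConfig δ) volume X with hf
  have hη2 : (0 : ℝ≥0∞) < η / 2 := ENNReal.half_pos hη.ne'
  have h₁ : ∀ᶠ δ in 𝓝[>] (0 : ℝ), f δ < η / 2 := hX (Iio_mem_nhds hη2)
  filter_upwards [h₁.prod_mk h₁] with p hp
  calc RandomPlanarGeometry.LoopConfig.cnLawEDist (triSitePercolation half) (siteLoopConfig p.1)
        (triSitePercolation half) (siteLoopConfig p.2)
      ≤ f p.1 + RandomPlanarGeometry.LoopConfig.cnLawEDist volume X (triSitePercolation half)
          (siteLoopConfig p.2) :=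
        RandomPlanarGeometry.LoopConfig.cnLawEDist_triangle (triSitePercolation half) volume
          (triSitePercolation half) (siteLoopConfig p.1) X (siteLoopConfig p.2)
          (measurableSet_isClose_siteLoopConfig p.1 p.2)
    _ = f p.1 + f p.2 := by rw [hf, RandomPlanarGeometry.LoopConfig.cnLawEDist_comm volume X]
    _ ≤ η / 2 + η / 2 := add_le_add hp.1.le hp.2.le
    _ = η := ENNReal.add_halves η

end Literature.Probability.Percolation

end
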